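import Summits.KontsevichZagierPeriods.Zeta5Search.Barrier.ConeGammaShift
import Summits.KontsevichZagierPeriods.Zeta5Search.Barrier.ConeGammaBreakpoints

/-!
# ζ(5) search — BARRIER: cluster data for the small-shift identity (far field and cluster scaling)

HONEST FRAMING (cell `pub-zeta5`): systematic search; no irrationality claim unless kernel-certified. MODEL objects
under Brown–Zudilin's (28)+(30) accounting ([BZ22] = arXiv:2210.03391); nothing here is a statement about `ζ(5)`;
records in print UNMOVED. Part 1/2 of item (P4) Lemma B of `BARRIER-PLAN.md` §2b (theory seat cert-2 g17, WAKE w3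
of lead/lit g23; source: P2 g11 `SE-STRUCTURE.md` §2). For a direction `a` with all 28 forms POSITIVE, a period `T`
and a shift `δ ∈ ℝ⁸`:

* data: `shiftSize δ = max_k |φ_k(δ)|` (`Y`), `xMin a`, `xMax a`, `clusterWidth a δ = Y/x_min + 1` (`W`),
  `clusterBound a δ = W·x_max + Y` (`K`), `wallDist a T` (`d > 0`: a lower bound for the distance to `ℤ` of the
  non-integer wall values `b·h_k` at the breakpoints `b` of `[0,T]`; `wallDist_pos`, `wallDist_le`);
* **`torusN_shift_eq_of_far`** (Claim 1, far field): at distance `≥ εW` from every breakpoint of `[0,T]` the shift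
  by `εδ` changes nothing, `𝒩(u·s(a) + εδ) = 𝒩(u·s(a))` (a floor can only change within `εY/x_min < εW` of a
  breakpoint);
* **`torusN_cluster_scaling`**, **`shiftDiff_scaling`** (Claim 2, from Lemma A `torusN_add_smul_of_germ`): for a
  breakpoint `b`, `|w| ≤ W` and `0 < ε ≤ ε'` with `ε'K < 1`, `ε'K < d`, the cluster difference
  `𝒩((b+εw)·s(a) + εδ) − 𝒩((b+εw)·s(a))` does not depend on `ε`.
Part 2/2 (`ConeGammaShiftLinear`) integrates these over one period.
-/

noncomputable section

open Set MeasureTheory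
open scoped Topology

namespace Summit.KontsevichZagierPeriods.Zeta5Search.Barrier.ConeGamma


/-! ### Size data of the direction and of the shift -/

/-- `Y(δ) = max_k |φ_k(δ)|`. -/
def shiftSize (δ : Fin 8 → ℝ) : ℝ :=
  (Finset.univ : Finset (Fin 28)).sup' Finset.univ_nonempty fun k => |phiForm δ k|

/-- `|φ_k(δ)| ≤ Y(δ)`. -/
theorem abs_phiForm_le_shiftSize (δ : Fin 8 → ℝ) (k : Fin 28) : |phiForm δ k| ≤ shiftSize δ :=
  Finset.le_sup' (fun k => |phiForm δ k|) (Finset.mem_univ k)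

/-- `0 ≤ Y(δ)`. -/
theorem shiftSize_nonneg (δ : Fin 8 → ℝ) : 0 ≤ shiftSize δ :=
  (abs_nonneg _).trans (abs_phiForm_le_shiftSize δ 0)

/-- Every pair form of the shift is bounded by `Y(δ)`. -/
theorem abs_pairForm_le_shiftSize (δ : Fin 8 → ℝ) {i j : Fin 8} (hij : i ≠ j) :
    |pairForm δ i j| ≤ shiftSize δ := by
  obtain ⟨k, hk⟩ := exists_phiForm_eq_pairForm δ hij
  rw [hk]; exact abs_phiForm_le_shiftSize δ k

/-- `Y(0) = 0`. -/
theorem shiftSize_zero : shiftSize (0 : Fin 8 → ℝ) = 0 := by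
  apply le_antisymm _ (shiftSize_nonneg 0)
  refine Finset.sup'_le _ _ fun k _ => ?_
  rw [phiForm_eq]
  simp [pairForm]

/-- `x_min(a) = min_k h_k(a)`. -/
def xMin (a : Dir) : ℝ := (Finset.univ : Finset (Fin 28)).inf' Finset.univ_nonempty (h28 a)

/-- `x_max(a) = max_k h_k(a)`. -/
def xMax (a : Dir) : ℝ := (Finset.univ : Finset (Fin 28)).sup' Finset.univ_nonempty (h28 a)

/-- `x_min ≤ h_k`. -/
theorem xMin_le (a : Dir) (k : Fin 28) : xMin a ≤ h28 a k := Finset.inf'_le _ (Finset.mem_univ k)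

/-- `h_k ≤ x_max`. -/
theorem le_xMax (a : Dir) (k : Fin 28) : h28 a k ≤ xMax a := Finset.le_sup' (h28 a) (Finset.mem_univ k)

/-- `x_min > 0` when all forms are positive. -/
theorem xMin_pos {a : Dir} (hpos : ∀ k, 0 < h28 a k) : 0 < xMin a := by
  obtain ⟨k, -, hk⟩ := Finset.exists_mem_eq_inf' Finset.univ_nonempty (h28 a)
  rw [xMin, hk]; exact hpos k

/-- `x_max > 0` when all forms are positive. -/
theorem xMax_pos {a : Dir} (hpos : ∀ k, 0 < h28 a k) : 0 < xMax a := (hpos 0).trans_le (le_xMax a 0)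

/-- Pair forms of `s(a)` are forms of `a`. -/
theorem exists_pairForm_sParam_eq (a : Dir) {i j : Fin 8} (hij : i ≠ j) :
    ∃ k : Fin 28, pairForm (sParam a) i j = h28 a k := by
  obtain ⟨k, hk⟩ := exists_phiForm_eq_pairForm (sParam a) hij
  exact ⟨k, by rw [hk, ← one_mul (h28 a k), ← phiForm_smul_sParam, one_smul]⟩

/-- The cluster half-width `W(a,δ) = Y(δ)/x_min(a) + 1`. -/
def clusterWidth (a : Dir) (δ : Fin 8 → ℝ) : ℝ := shiftSize δ / xMin a + 1

/-- The displacement bound `K(a,δ) = W·x_max + Y`. -/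
def clusterBound (a : Dir) (δ : Fin 8 → ℝ) : ℝ := clusterWidth a δ * xMax a + shiftSize δ

/-- `W > 0`. -/
theorem clusterWidth_pos {a : Dir} (hpos : ∀ k, 0 < h28 a k) (δ : Fin 8 → ℝ) : 0 < clusterWidth a δ := by
  unfold clusterWidth
  have := div_nonneg (shiftSize_nonneg δ) (xMin_pos hpos).le
  linarith

/-- `Y ≤ (Y/x_min)·h_k` for every form. -/
theorem shiftSize_le_div_mul {a : Dir} (hpos : ∀ k, 0 < h28 a k) (δ : Fin 8 → ℝ) (k : Fin 28) :
    shiftSize δ ≤ shiftSize δ / xMin a * h28 a k := by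
  rw [div_mul_eq_mul_div, le_div_iff₀ (xMin_pos hpos)]
  exact mul_le_mul_of_nonneg_left (xMin_le a k) (shiftSize_nonneg δ)

/-! ### Wall distances at the breakpoints -/

open scoped Classical in
/-- A positive lower bound `d` for the distance to `ℤ` of the NON-integer wall values `b·h_k(a)` at the breakpoints
`b` of `[0,T]` (`= 1` if every wall value at every breakpoint is an integer). -/
def wallDist (a : Dir) (T : ℝ) : ℝ :=
  if h : (((bkpts a T) ×ˢ (Finset.univ : Finset (Fin 28))).filter
      (fun p : ℝ × Fin 28 => ∀ z : ℤ, p.1 * h28 a p.2 ≠ z)).Nonempty then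
    (((bkpts a T) ×ˢ (Finset.univ : Finset (Fin 28))).filter
      (fun p : ℝ × Fin 28 => ∀ z : ℤ, p.1 * h28 a p.2 ≠ z)).inf' h
      (fun p => |p.1 * h28 a p.2 - round (p.1 * h28 a p.2)|)
  else 1

open scoped Classical in
/-- `d > 0`. -/
theorem wallDist_pos (a : Dir) (T : ℝ) : 0 < wallDist a T := by
  unfold wallDist
  split_ifs with h
  · rw [Finset.lt_inf'_iff]
    intro p hp
    have hp' := (Finset.mem_filter.mp hp).2
    rw [abs_pos, sub_ne_zero]
    exact hp' (round (p.1 * h28 a p.2))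
  · exact one_pos

open scoped Classical in
/-- `d ≤ |b·h_k − z|` for every breakpoint `b`, every form `k` with `b·h_k ∉ ℤ`, and every integer `z`. -/
theorem wallDist_le {a : Dir} {T b : ℝ} (hb : b ∈ bkpts a T) (k : Fin 28) (hnz : ∀ z : ℤ, b * h28 a k ≠ z)
    (z : ℤ) : wallDist a T ≤ |b * h28 a k - z| := by
  unfold wallDist
  have hmem : (b, k) ∈ ((bkpts a T) ×ˢ (Finset.univ : Finset (Fin 28))).filter
      (fun p : ℝ × Fin 28 => ∀ z : ℤ, p.1 * h28 a p.2 ≠ z) :=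
    Finset.mem_filter.mpr ⟨Finset.mem_product.mpr ⟨hb, Finset.mem_univ k⟩, hnz⟩
  rw [dif_pos ⟨_, hmem⟩]
  exact (Finset.inf'_le (fun p : ℝ × Fin 28 => |p.1 * h28 a p.2 - round (p.1 * h28 a p.2)|) hmem).trans
    (round_le (b * h28 a k) z)

/-! ### Claim 1: far from the breakpoints the shift changes nothing -/

/-- **Far field**: if `0 ≤ u ≤ T` is at distance `≥ ε·W` from every breakpoint of `[0,T]` (and `εY < 1`), then
`𝒩(u·s(a) + ε·δ) = 𝒩(u·s(a))` (a floor could only change within `ε·Y/x_min < ε·W` of a breakpoint). -/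
theorem torusN_shift_eq_of_far {a : Dir} (hpos : ∀ k, 0 < h28 a k) {T : ℝ}
    (hper : ∀ k : Fin 28, ∃ z : ℤ, T * h28 a k = z) (δ : Fin 8 → ℝ) {ε u : ℝ} (hε : 0 ≤ ε)
    (hεY : ε * shiftSize δ < 1) (hu0 : 0 ≤ u) (huT : u ≤ T)
    (hfar : ∀ b ∈ bkpts a T, ε * clusterWidth a δ ≤ |u - b|) :
    torusN (u • sParam a + ε • δ) = torusN (u • sParam a) := by
  rcases hε.eq_or_lt with h0 | hεpos
  · rw [← h0, zero_smul, add_zero]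
  refine torusN_congr_floor fun i j hij => ?_
  obtain ⟨k, hk⟩ := exists_pairForm_sParam_eq a hij
  have hy : |pairForm δ i j| ≤ shiftSize δ := abs_pairForm_le_shiftSize δ hij
  rw [pairForm_add, pairForm_smul, pairForm_smul, hk]
  have hx := hpos k
  have key : ∀ z : ℤ, |ε * pairForm δ i j| < |u * h28 a k - z| := by
    intro z
    by_contra hcon
    push Not at hcon
    have hεy : |ε * pairForm δ i j| ≤ ε * shiftSize δ := by
      rw [abs_mul, abs_of_nonneg hε]; exact mul_le_mul_of_nonneg_left hy hε
    have hlt1 : |u * h28 a k - z| < 1 := (hcon.trans hεy).trans_lt hεY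
    have hux : 0 ≤ u * h28 a k := mul_nonneg hu0 hx.le
    have huxT : u * h28 a k ≤ T * h28 a k := mul_le_mul_of_nonneg_right huT hx.le
    have hz0 : 0 ≤ z := by
      by_contra hz
      push Not at hz
      have hz' : (z : ℝ) ≤ -1 := by exact_mod_cast (show z ≤ -1 by omega)
      have : 1 ≤ |u * h28 a k - z| := by
        rw [abs_of_nonneg (by linarith)]; linarith
      linarith
    obtain ⟨zT, hzT⟩ := hper k
    have hzle : (z : ℝ) ≤ T * h28 a k := by
      by_contra hz
      push Not at hz
      rw [hzT] at hz
      have hz1 : zT < z := by exact_mod_cast hz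
      have hz' : (zT : ℝ) + 1 ≤ z := by exact_mod_cast (show zT + 1 ≤ z by omega)
      have : 1 ≤ |u * h28 a k - z| := by
        rw [abs_of_nonpos (by linarith)]; linarith
      linarith
    have hbmem : (z : ℝ) / h28 a k ∈ bkpts a T := div_mem_bkpts hx hz0 (by rwa [div_le_iff₀ hx])
    have hdist : |u - z / h28 a k| < ε * clusterWidth a δ := by
      have hrew : u - z / h28 a k = (u * h28 a k - z) / h28 a k := by field_simp
      rw [hrew, abs_div, abs_of_pos hx, div_lt_iff₀ hx]
      calc |u * h28 a k - z| ≤ ε * shiftSize δ := hcon.trans hεy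
        _ ≤ ε * (shiftSize δ / xMin a * h28 a k) :=
          mul_le_mul_of_nonneg_left (shiftSize_le_div_mul hpos δ k) hε
        _ < ε * (clusterWidth a δ * h28 a k) := by
          refine mul_lt_mul_of_pos_left ?_ hεpos
          unfold clusterWidth
          nlinarith
        _ = ε * clusterWidth a δ * h28 a k := by ring
    exact absurd (hfar _ hbmem) (not_le.mpr hdist)
  have h := floor_add_mul_eq_of_nonmember key zero_le_one le_rfl
  rw [one_mul] at h
  exact h

/-! ### Claim 2: inside a cluster the difference is scale-free -/

/-- **At a breakpoint the saving is conical** for displacements below the wall distance: for `b ∈ bkpts`,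
`𝒩(b·s(a) + t·Δ) = 𝒩(b·s(a) + Δ)` for `0 < t ≤ 1` whenever every pair form of `Δ` is `< 1` and `< d` in size. -/
theorem torusN_cluster_scaling {a : Dir} {T b : ℝ} (hb : b ∈ bkpts a T) {Δ : Fin 8 → ℝ}
    (hΔ1 : ∀ i j : Fin 8, i ≠ j → |pairForm Δ i j| < 1)
    (hΔ2 : ∀ i j : Fin 8, i ≠ j → |pairForm Δ i j| < wallDist a T)
    {t : ℝ} (ht0 : 0 < t) (ht1 : t ≤ 1) : torusN (b • sParam a + t • Δ) = torusN (b • sParam a + Δ) := by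
  refine torusN_add_smul_of_germ (fun i j hij => ?_) ht0 ht1
  obtain ⟨k, hk⟩ := exists_pairForm_sParam_eq a hij
  rw [pairForm_smul, hk]
  by_cases hmem : ∃ z : ℤ, b * h28 a k = z
  · exact Or.inl ⟨hmem, hΔ1 i j hij⟩
  · push Not at hmem
    exact Or.inr fun z => (hΔ2 i j hij).trans_le (wallDist_le hb k hmem z)

/-- Size of the displacement `ε'·(w·s(a) + δ')` inside a cluster: its pair forms are at most `ε'·K` when
`|w| ≤ W` and `Y(δ') ≤ Y(δ)` (used with `δ' = δ` and `δ' = 0`). -/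
theorem abs_pairForm_disp_le {a : Dir} (hpos : ∀ k, 0 < h28 a k) (δ : Fin 8 → ℝ) {δ' : Fin 8 → ℝ}
    (hδ' : shiftSize δ' ≤ shiftSize δ) {w : ℝ} (hw : |w| ≤ clusterWidth a δ) {ε' : ℝ} (hε' : 0 ≤ ε')
    {i j : Fin 8} (hij : i ≠ j) : |pairForm (ε' • (w • sParam a + δ')) i j| ≤ ε' * clusterBound a δ := by
  obtain ⟨k, hk⟩ := exists_pairForm_sParam_eq a hij
  rw [pairForm_smul, pairForm_add, pairForm_smul, hk, abs_mul, abs_of_nonneg hε']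
  refine mul_le_mul_of_nonneg_left ?_ hε'
  unfold clusterBound
  calc |w * h28 a k + pairForm δ' i j| ≤ |w * h28 a k| + |pairForm δ' i j| := abs_add_le _ _
    _ ≤ |w| * h28 a k + shiftSize δ := by
        rw [abs_mul, abs_of_pos (hpos k)]
        exact add_le_add le_rfl ((abs_pairForm_le_shiftSize δ' hij).trans hδ')
    _ ≤ clusterWidth a δ * xMax a + shiftSize δ := by
        have := mul_le_mul hw (le_xMax a k) (hpos k).le (clusterWidth_pos hpos δ).le
        linarith

/-- **Scale-freeness of the cluster difference**: for a breakpoint `b`, `|w| ≤ W`, and `0 < ε ≤ ε'` with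
`ε'K < 1`, `ε'K < d`:
`𝒩((b+εw)·s(a) + εδ) − 𝒩((b+εw)·s(a)) = 𝒩((b+ε'w)·s(a) + ε'δ) − 𝒩((b+ε'w)·s(a))`. -/
theorem shiftDiff_scaling {a : Dir} (hpos : ∀ k, 0 < h28 a k) {T b : ℝ} (hb : b ∈ bkpts a T)
    (δ : Fin 8 → ℝ) {ε ε' w : ℝ} (hε : 0 < ε) (hεε' : ε ≤ ε') (hw : |w| ≤ clusterWidth a δ)
    (h1 : ε' * clusterBound a δ < 1) (h2 : ε' * clusterBound a δ < wallDist a T) :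
    (torusN ((b + ε * w) • sParam a + ε • δ) : ℝ) - torusN ((b + ε * w) • sParam a) =
      (torusN ((b + ε' * w) • sParam a + ε' • δ) : ℝ) - torusN ((b + ε' * w) • sParam a) := by
  have hε' : 0 < ε' := hε.trans_le hεε'
  have ht0 : 0 < ε / ε' := div_pos hε hε'
  have ht1 : ε / ε' ≤ 1 := (div_le_one hε').mpr hεε'
  -- the shifted term
  have hA : ∀ (δ' : Fin 8 → ℝ), shiftSize δ' ≤ shiftSize δ →
      torusN ((b + ε * w) • sParam a + ε • δ') = torusN ((b + ε' * w) • sParam a + ε' • δ') := by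
    intro δ' hδ'
    have e1 : (b + ε * w) • sParam a + ε • δ' = b • sParam a + (ε / ε') • (ε' • (w • sParam a + δ')) := by
      ext n; simp only [Pi.add_apply, Pi.smul_apply, smul_eq_mul]; field_simp; ring
    have e2 : (b + ε' * w) • sParam a + ε' • δ' = b • sParam a + ε' • (w • sParam a + δ') := by
      ext n; simp only [Pi.add_apply, Pi.smul_apply, smul_eq_mul]; ring
    rw [e1, e2]
    refine torusN_cluster_scaling hb (fun i j hij => ?_) (fun i j hij => ?_) ht0 ht1
    · exact (abs_pairForm_disp_le hpos δ hδ' hw hε'.le hij).trans_lt h1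
    · exact (abs_pairForm_disp_le hpos δ hδ' hw hε'.le hij).trans_lt h2
  have hB := hA 0 (by rw [shiftSize_zero]; exact shiftSize_nonneg δ)
  simp only [smul_zero, add_zero] at hB
  rw [hA δ le_rfl, hB]

end Summit.KontsevichZagierPeriods.Zeta5Search.Barrier.ConeGamma

end
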